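import Summits.ResolutionOfSingularities.ResolutionOfSingularities.Theorems.TameCutKernels
import Summits.ResolutionOfSingularities.ResolutionOfSingularities.Theorems.MaxContactCutRiderCut
import Summits.ResolutionOfSingularities.ResolutionOfSingularities.Theorems.MaxContactCutContactShadow
import HarnessLib

/-!
# MaxContactCutTameCut — decomp-res node «TameCut» (lens-4 g21) refining the MaxContactCut aside 32260; tree
file 3/3 of the node

Content VERBATIM from the decomp-res lens-4 g21 file `HOME/decomp-res-lens-4/g21/TameCut.lean` (sha256 ad77f9303f4ee357 ≡
`parts/TameCut-NODE-ad77f930.lean`, 786 l, written directly against the tree: no copy of earlier generations).  HOME =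
run/shared/lean/pub/decomp-res.  Critic: CRITIC-LEDGER row 134 CLEARED, landing order 2026-08-30T19:16:20Z.

Inside the Theses cone: §46 BY NAME — the tame–separable slabs onto 31571
`MaxContactCut.NoContactHuggingTowers` (`…_of_item`), the
DECIDED perfect tame cells modulo the g12 ports (`noTowerTamePerfect_of_ports`, `tamePerfect…_of_ports` via the tree's
`MaxContactCutContactShadow.contactPerfect_of_ports`), EXACT `noOffLocusShadowTowers_iff_g21` /
`noNonPrincipalInLocusTowers_iff_g21`
(GIVEN 31571) and `…_iff_cells_g21`, 31572 `noWildHuggingTowers_iff_g21` (NO hypothesis), the root / host: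
`noForcedTowers_of_g21`, `noForcedTowers_iff_g21`, `noSingularSurfaceHuggingTowers_of_g21` / `_iff_g21` / `_iff_g21'`,
up-links `noSurfaceHuggingTowers_of_g21`, `noHuggingTowers_of_g21`.

[WRITER NOTE (decomp-res writer g6): namespace `…Theorems.HugValuationCut` as the whole lens-4 chain; split by the
critic's order into
`TameCutClasses` (cone-free: §43 axes, §45 cell classes, §46 all-weights classes, §47 arithmetic certificate —
the g20 arithmetic
file the critic names for §47 is not in the tree yet), `TameCutKernels` (cone-free: §44 the tame contact theorem +
the §45 kernels /
EXACT re-locations at weight `n`) and `MaxContactCutTameCut` (inside the Theses cone: §46 BY-NAME wiring).  Nothing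
else changed.]

(Sources: Giraud1975; EncinasVillamayor2000 Thm. 4.9; BravoGarciaEscamillaVillamayor2012 Lemma 4.6; EGAIV4 §16.8,
Thm. 16.11.2; StacksProject 00TV, 0BIQ; Liu2002 Thm. 8.1.19; BierstoneGrigorievMilmanWlodarczyk2011 §3, Lemma
3.6.2; Kollar2007 3.57; CossartJannsenSaito2020; CossartPiltant2019; Cutkosky2009 Thm. 5.1; Moh1987.)
-/

noncomputable section

open CategoryTheory AlgebraicGeometry IsLocalRing
open Literature.AlgebraicGeometry.Resolution
open Summit.ResolutionOfSingularities.ResolutionOfSingularities.Theses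
open Summit.ResolutionOfSingularities.ResolutionOfSingularities.Theorems
open WeakOrderReduction ForcedTowerClasses DivergentTowerClasses MonomialTowerClasses
open HugDimensionClasses HugDimensionKernels SurfaceShadowClasses SurfaceShadowKernels
open ContactShadowClasses (NoTowerImperfect ContactShadow TowerObstructsAll ContactPerfect)
open ContactShadowKernels (noTowerImperfect_of_noTower noTowerImperfect_mono noTower_iff_columns)
open NearPointCut (SingularClass singularSurface_iff_noTower)
open AbsoluteContactClasses (IsAbsContactAt SepResidueAt AbsInv absInv_point hsPortSepResidue sepResidueAt_of_perfectField not_perfectField_of_not_sepResidueAt diffIdeal_restrict_le)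

namespace Summit.ResolutionOfSingularities.ResolutionOfSingularities.Theorems.HugValuationCut

/-! ## §46 (g21 · NEW) Up to the booked MaxContactCut items BY NAME — all weights (classes in `TameCutClasses`) -/

/-- **KERNEL — (O, tame, separable root) from 31571 `NoContactHuggingTowers` BY NAME.** [folklore] -/
theorem noTameSepOffLocusTowers_of_item (h : MaxContactCut.NoContactHuggingTowers) : NoTameSepOffLocusTowers :=
  fun n hn => tameSepOffLocus_of_contact (h n hn)

/-- **KERNEL — (L,¬P, tame, separable root) from 31571 BY NAME.** [folklore] -/
theorem noTameSepNonPrincipalInLocusTowers_of_item (h : MaxContactCut.NoContactHuggingTowers) :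
    NoTameSepNonPrincipalInLocusTowers :=
  fun n hn => tameSepNonPrincipal_of_contact (h n hn)

/-- **THE DECIDED CELL — (O, tame, PERFECT k) is EMPTY modulo the g12 ports `ContactShadow`, `TowerObstructsAll` and X1
`MaxContactCut.MarkedThreefoldResolution` (28616, KNOWN-MOD-PORT)** — the tree's `contactPerfect_of_ports` composed with
the tame contact theorem. [folklore] -/
theorem noTowerTamePerfect_of_ports {n : ℕ} {P : ForcedTower → Prop} (hS : ContactShadow n) (hO : TowerObstructsAll)
    (hX : MaxContactCut.MarkedThreefoldResolution) : NoTowerTamePerfect n P :=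
  noTowerTamePerfect_of_contactPerfect (MaxContactCutContactShadow.contactPerfect_of_ports hS hO hX)

/-- **(O, tame, perfect) at weight `n` DECIDED-MOD-PORT(KNOWN).** [folklore] -/
theorem tamePerfectOffLocus_of_ports {n : ℕ} (hS : ContactShadow n) (hO : TowerObstructsAll)
    (hX : MaxContactCut.MarkedThreefoldResolution) : TamePerfectOffLocusTowersTerminate n :=
  noTowerTamePerfect_of_ports hS hO hX

/-- **(L,¬P, tame, perfect) at weight `n` DECIDED-MOD-PORT(KNOWN).** [folklore] -/
theorem tamePerfectNonPrincipal_of_ports {n : ℕ} (hS : ContactShadow n) (hO : TowerObstructsAll)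
    (hX : MaxContactCut.MarkedThreefoldResolution) : TamePerfectNonPrincipalInLocusTowersTerminate n :=
  noTowerTamePerfect_of_ports hS hO hX

/-- **(O, tame, perfect) over all weights DECIDED-MOD-PORT(KNOWN).** [folklore] -/
theorem noTamePerfectOffLocusTowers_of_ports (hS : ∀ n : ℕ, 1 ≤ n → ContactShadow n) (hO : TowerObstructsAll)
    (hX : MaxContactCut.MarkedThreefoldResolution) : NoTamePerfectOffLocusTowers :=
  fun n hn => tamePerfectOffLocus_of_ports (hS n hn) hO hX

/-- **(L,¬P, tame, perfect) over all weights DECIDED-MOD-PORT(KNOWN).** [folklore] -/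
theorem noTamePerfectNonPrincipalInLocusTowers_of_ports (hS : ∀ n : ℕ, 1 ≤ n → ContactShadow n) (hO : TowerObstructsAll)
    (hX : MaxContactCut.MarkedThreefoldResolution) : NoTamePerfectNonPrincipalInLocusTowers :=
  fun n hn => tamePerfectNonPrincipal_of_ports (hS n hn) hO hX

/-- **EXACT RE-LOCATION of (O) over all weights GIVEN 31571.** [folklore] -/
theorem noOffLocusShadowTowers_iff_g21 (h71 : MaxContactCut.NoContactHuggingTowers) :
    NoOffLocusShadowTowers ↔ NoWildOffLocusTowers ∧ NoTameInsepOffLocusTowers :=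
  ⟨fun h => ⟨fun n hn => wildOffLocus_of_offLocus (h n hn), fun n hn => tameInsepOffLocus_of_offLocus (h n hn)⟩,
    fun h n hn => (offLocus_iff_g21 (h71 n hn)).mpr ⟨h.1 n hn, h.2 n hn⟩⟩

/-- **EXACT RE-LOCATION of (L,¬P) over all weights GIVEN 31571.** [folklore] -/
theorem noNonPrincipalInLocusTowers_iff_g21 (h71 : MaxContactCut.NoContactHuggingTowers) :
    NoNonPrincipalInLocusTowers ↔ NoWildNonPrincipalInLocusTowers ∧ NoTameInsepNonPrincipalInLocusTowers :=
  ⟨fun h => ⟨fun n hn => wildNonPrincipal_of_nonPrincipal (h n hn), fun n hn => tameInsepNonPrincipal_of_nonPrincipal (h n hn)⟩,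
    fun h n hn => (nonPrincipal_iff_g21 (h71 n hn)).mpr ⟨h.1 n hn, h.2 n hn⟩⟩

/-- EXACT of (O) over all weights, NO hypothesis (the tame-separable slab as an explicit conjunct). [folklore] -/
theorem noOffLocusShadowTowers_iff_cells_g21 :
    NoOffLocusShadowTowers ↔ NoWildOffLocusTowers ∧ NoTameSepOffLocusTowers ∧ NoTameInsepOffLocusTowers :=
  ⟨fun h => ⟨fun n hn => (offLocus_iff_cells_g21.mp (h n hn)).1, fun n hn => (offLocus_iff_cells_g21.mp (h n hn)).2.1,
      fun n hn => (offLocus_iff_cells_g21.mp (h n hn)).2.2⟩,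
    fun h n hn => offLocus_iff_cells_g21.mpr ⟨h.1 n hn, h.2.1 n hn, h.2.2 n hn⟩⟩

/-- EXACT of (L,¬P) over all weights, NO hypothesis. [folklore] -/
theorem noNonPrincipalInLocusTowers_iff_cells_g21 :
    NoNonPrincipalInLocusTowers ↔ NoWildNonPrincipalInLocusTowers ∧ NoTameSepNonPrincipalInLocusTowers ∧
      NoTameInsepNonPrincipalInLocusTowers :=
  ⟨fun h => ⟨fun n hn => (nonPrincipal_iff_cells_g21.mp (h n hn)).1,
      fun n hn => (nonPrincipal_iff_cells_g21.mp (h n hn)).2.1, fun n hn => (nonPrincipal_iff_cells_g21.mp (h n hn)).2.2⟩,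
    fun h n hn => nonPrincipal_iff_cells_g21.mpr ⟨h.1 n hn, h.2.1 n hn, h.2.2 n hn⟩⟩

/-- **31572 `MaxContactCut.NoWildHuggingTowers` BY NAME, EXACT and hypothesis-free: `⟺ (wild weight) ∧ (tame,
insep root)`.** [folklore] -/
theorem noWildHuggingTowers_iff_g21 :
    MaxContactCut.NoWildHuggingTowers ↔ NoWildWildHuggingTowers ∧ NoTameInsepWildHuggingTowers :=
  ⟨fun h => ⟨fun n hn => (wildHugging_iff_g21.mp (h n hn)).1, fun n hn => (wildHugging_iff_g21.mp (h n hn)).2⟩,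
    fun h n hn => wildHugging_iff_g21.mpr ⟨h.1 n hn, h.2 n hn⟩⟩

/-- 31571 is part of 30253 (pure logic). [folklore] -/
theorem noContactHuggingTowers_of_noForcedTowers (h : MaxContactCut.NoForcedTowers) : MaxContactCut.NoContactHuggingTowers :=
  fun n hn p hp k _ _ T g hB hD hE _ => h n hn p hp k T g hB hD hE

/-- **30253 `MaxContactCut.NoForcedTowers` BY NAME from the g21 cells, 31571 and the ports.** [folklore] -/
theorem noForcedTowers_of_g21 (hMo : MaxContactCut.MonomialCornerAll) (hC : MaxContactCut.CurveLawAll)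
    (hSL : MaxContactCut.SurfaceLawAll) (hH : MaxContactCut.NoHypersurfaceHuggingTowers) (hP : ShadowPortAll)
    (hM : MarkingPortAll) (hDesc : DescentPortAll) (hFC : FactorContactPortAll) (hCo : CouplingPortAll)
    (hRi : RiderPortAll) (h71 : MaxContactCut.NoContactHuggingTowers) (hWO : NoWildOffLocusTowers)
    (hTO : NoTameInsepOffLocusTowers) (hWN : NoWildNonPrincipalInLocusTowers) (hTN : NoTameInsepNonPrincipalInLocusTowers)
    (hPu : NoPurePrincipalTowers) (hR : NoIncommensurableWildDriftingImperfectTowers) : MaxContactCut.NoForcedTowers :=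
  noForcedTowers_of_g19 hMo hC hSL hH hP hM hDesc hFC hCo hRi ((noOffLocusShadowTowers_iff_g21 h71).mpr ⟨hWO, hTO⟩)
    ((noNonPrincipalInLocusTowers_iff_g21 h71).mpr ⟨hWN, hTN⟩) hPu hR

/-- **EXACT AT THE ROOT 30253 (g19's hypothesis list EXACTLY; 31571 as a booked conjunct):
`NoForcedTowers ⟺ 31571 ∧ (O,wild) ∧ (O,tame,insep) ∧ (L,¬P,wild) ∧ (L,¬P,tame,insep) ∧ (L,P,pure) ∧
(imperfect residual)`.** [folklore] -/
theorem noForcedTowers_iff_g21 (hMo : MaxContactCut.MonomialCornerAll) (hC : MaxContactCut.CurveLawAll)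
    (hSL : MaxContactCut.SurfaceLawAll) (hH : MaxContactCut.NoHypersurfaceHuggingTowers) (hP : ShadowPortAll)
    (hM : MarkingPortAll) (hDesc : DescentPortAll) (hFC : FactorContactPortAll) (hCo : CouplingPortAll)
    (hRi : RiderPortAll) :
    MaxContactCut.NoForcedTowers ↔
      MaxContactCut.NoContactHuggingTowers ∧ NoWildOffLocusTowers ∧ NoTameInsepOffLocusTowers ∧
        NoWildNonPrincipalInLocusTowers ∧ NoTameInsepNonPrincipalInLocusTowers ∧ NoPurePrincipalTowers ∧
          NoIncommensurableWildDriftingImperfectTowers := by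
  refine ⟨fun h => ?_, fun h => noForcedTowers_of_g21 hMo hC hSL hH hP hM hDesc hFC hCo hRi h.1 h.2.1 h.2.2.1 h.2.2.2.1
    h.2.2.2.2.1 h.2.2.2.2.2.1 h.2.2.2.2.2.2⟩
  have h19 := (noForcedTowers_iff_g19 hMo hC hSL hH hP hM hDesc hFC hCo hRi).mp h
  have h71 := noContactHuggingTowers_of_noForcedTowers h
  exact ⟨h71, ((noOffLocusShadowTowers_iff_g21 h71).mp h19.1).1, ((noOffLocusShadowTowers_iff_g21 h71).mp h19.1).2,
    ((noNonPrincipalInLocusTowers_iff_g21 h71).mp h19.2.1).1, ((noNonPrincipalInLocusTowers_iff_g21 h71).mp h19.2.1).2,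
    h19.2.2.1, h19.2.2.2⟩

/-- **THE HOST 32260 `MaxContactCut.NoSingularSurfaceHuggingTowers` BY NAME from the g21 cells, 31571 and the
ports.** [folklore] -/
theorem noSingularSurfaceHuggingTowers_of_g21 (hMo : MaxContactCut.MonomialCornerAll) (hC : MaxContactCut.CurveLawAll)
    (hSL : MaxContactCut.SurfaceLawAll) (hH : MaxContactCut.NoHypersurfaceHuggingTowers) (hP : ShadowPortAll)
    (hM : MarkingPortAll) (hDesc : DescentPortAll) (hFC : FactorContactPortAll) (hCo : CouplingPortAll)
    (hRi : RiderPortAll) (h71 : MaxContactCut.NoContactHuggingTowers) (hWO : NoWildOffLocusTowers)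
    (hTO : NoTameInsepOffLocusTowers) (hWN : NoWildNonPrincipalInLocusTowers) (hTN : NoTameInsepNonPrincipalInLocusTowers)
    (hPu : NoPurePrincipalTowers) (hR : NoIncommensurableWildDriftingImperfectTowers) :
    MaxContactCut.NoSingularSurfaceHuggingTowers :=
  noSingularSurfaceHuggingTowers_of_g19 hMo hC hSL hH hP hM hDesc hFC hCo hRi
    ((noOffLocusShadowTowers_iff_g21 h71).mpr ⟨hWO, hTO⟩) ((noNonPrincipalInLocusTowers_iff_g21 h71).mpr ⟨hWN, hTN⟩) hPu hR

/-- **EXACT AT THE HOST 32260 GIVEN 31571 (tree g19 ports):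
`32260 ⟺ (O,wild) ∧ (O,tame,insep) ∧ (L,¬P,wild) ∧ (L,¬P,tame,insep) ∧ (L,P,pure) ∧ (imperfect
residual)`.** [folklore] -/
theorem noSingularSurfaceHuggingTowers_iff_g21 (hMo : MaxContactCut.MonomialCornerAll) (hC : MaxContactCut.CurveLawAll)
    (hSL : MaxContactCut.SurfaceLawAll) (hH : MaxContactCut.NoHypersurfaceHuggingTowers) (hP : ShadowPortAll)
    (hM : MarkingPortAll) (hDesc : DescentPortAll) (hFC : FactorContactPortAll) (hCo : CouplingPortAll)
    (hRi : RiderPortAll) (h71 : MaxContactCut.NoContactHuggingTowers) :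
    MaxContactCut.NoSingularSurfaceHuggingTowers ↔
      NoWildOffLocusTowers ∧ NoTameInsepOffLocusTowers ∧ NoWildNonPrincipalInLocusTowers ∧
        NoTameInsepNonPrincipalInLocusTowers ∧ NoPurePrincipalTowers ∧ NoIncommensurableWildDriftingImperfectTowers := by
  refine ⟨fun h => ?_, fun h => noSingularSurfaceHuggingTowers_of_g21 hMo hC hSL hH hP hM hDesc hFC hCo hRi h71 h.1 h.2.1
    h.2.2.1 h.2.2.2.1 h.2.2.2.2.1 h.2.2.2.2.2⟩
  have h19 := (noSingularSurfaceHuggingTowers_iff_g19 hMo hC hSL hH hP hM hDesc hFC hCo hRi).mp h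
  exact ⟨((noOffLocusShadowTowers_iff_g21 h71).mp h19.1).1, ((noOffLocusShadowTowers_iff_g21 h71).mp h19.1).2,
    ((noNonPrincipalInLocusTowers_iff_g21 h71).mp h19.2.1).1, ((noNonPrincipalInLocusTowers_iff_g21 h71).mp h19.2.1).2,
    h19.2.2.1, h19.2.2.2⟩

/-- **EXACT AT THE HOST 32260 with g19's hypothesis list EXACTLY** — the tame–separable slabs kept as explicit conjuncts
(certified `⊆ 31571` by `noTameSepOffLocusTowers_of_item` / `noTameSepNonPrincipalInLocusTowers_of_item`, and their perfect
columns DECIDED by `…_of_ports`). [folklore] -/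
theorem noSingularSurfaceHuggingTowers_iff_g21' (hMo : MaxContactCut.MonomialCornerAll) (hC : MaxContactCut.CurveLawAll)
    (hSL : MaxContactCut.SurfaceLawAll) (hH : MaxContactCut.NoHypersurfaceHuggingTowers) (hP : ShadowPortAll)
    (hM : MarkingPortAll) (hDesc : DescentPortAll) (hFC : FactorContactPortAll) (hCo : CouplingPortAll)
    (hRi : RiderPortAll) :
    MaxContactCut.NoSingularSurfaceHuggingTowers ↔
      (NoTameSepOffLocusTowers ∧ NoTameSepNonPrincipalInLocusTowers) ∧ NoWildOffLocusTowers ∧ NoTameInsepOffLocusTowers ∧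
        NoWildNonPrincipalInLocusTowers ∧ NoTameInsepNonPrincipalInLocusTowers ∧ NoPurePrincipalTowers ∧
          NoIncommensurableWildDriftingImperfectTowers := by
  rw [noSingularSurfaceHuggingTowers_iff_g19 hMo hC hSL hH hP hM hDesc hFC hCo hRi, noOffLocusShadowTowers_iff_cells_g21,
    noNonPrincipalInLocusTowers_iff_cells_g21]
  constructor
  · rintro ⟨⟨hWO, hTSO, hTIO⟩, ⟨hWN, hTSN, hTIN⟩, hPu, hR⟩
    exact ⟨⟨hTSO, hTSN⟩, hWO, hTIO, hWN, hTIN, hPu, hR⟩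
  · rintro ⟨⟨hTSO, hTSN⟩, hWO, hTIO, hWN, hTIN, hPu, hR⟩
    exact ⟨⟨hWO, hTSO, hTIO⟩, ⟨hWN, hTSN, hTIN⟩, hPu, hR⟩

/-- 32203 `MaxContactCut.NoSurfaceHuggingTowers` BY NAME (up-link). [folklore] -/
theorem noSurfaceHuggingTowers_of_g21 (hMo : MaxContactCut.MonomialCornerAll) (hC : MaxContactCut.CurveLawAll)
    (hSL : MaxContactCut.SurfaceLawAll) (hH : MaxContactCut.NoHypersurfaceHuggingTowers) (hP : ShadowPortAll)
    (hM : MarkingPortAll) (hDesc : DescentPortAll) (hFC : FactorContactPortAll) (hCo : CouplingPortAll)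
    (hRi : RiderPortAll) (h71 : MaxContactCut.NoContactHuggingTowers) (hWO : NoWildOffLocusTowers)
    (hTO : NoTameInsepOffLocusTowers) (hWN : NoWildNonPrincipalInLocusTowers) (hTN : NoTameInsepNonPrincipalInLocusTowers)
    (hPu : NoPurePrincipalTowers) (hR : NoIncommensurableWildDriftingImperfectTowers) : MaxContactCut.NoSurfaceHuggingTowers :=
  noSurfaceHuggingTowers_of_g19 hMo hC hSL hH hP hM hDesc hFC hCo hRi ((noOffLocusShadowTowers_iff_g21 h71).mpr ⟨hWO, hTO⟩)
    ((noNonPrincipalInLocusTowers_iff_g21 h71).mpr ⟨hWN, hTN⟩) hPu hR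

/-- 31570 `MaxContactCut.NoHuggingTowers` BY NAME (up-link). [folklore] -/
theorem noHuggingTowers_of_g21 (hMo : MaxContactCut.MonomialCornerAll) (hC : MaxContactCut.CurveLawAll)
    (hSL : MaxContactCut.SurfaceLawAll) (hH : MaxContactCut.NoHypersurfaceHuggingTowers) (hP : ShadowPortAll)
    (hM : MarkingPortAll) (hDesc : DescentPortAll) (hFC : FactorContactPortAll) (hCo : CouplingPortAll)
    (hRi : RiderPortAll) (h71 : MaxContactCut.NoContactHuggingTowers) (hWO : NoWildOffLocusTowers)
    (hTO : NoTameInsepOffLocusTowers) (hWN : NoWildNonPrincipalInLocusTowers) (hTN : NoTameInsepNonPrincipalInLocusTowers)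
    (hPu : NoPurePrincipalTowers) (hR : NoIncommensurableWildDriftingImperfectTowers) : MaxContactCut.NoHuggingTowers :=
  noHuggingTowers_of_g19 hMo hC hSL hH hP hM hDesc hFC hCo hRi ((noOffLocusShadowTowers_iff_g21 h71).mpr ⟨hWO, hTO⟩)
    ((noNonPrincipalInLocusTowers_iff_g21 h71).mpr ⟨hWN, hTN⟩) hPu hR

end Summit.ResolutionOfSingularities.ResolutionOfSingularities.Theorems.HugValuationCut
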